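/-
COR-CM (cell pub-hodgecm2, stage 2 of the Hodge ladder) — count-neutral own lane PERL-WEIL-LINE, sequel F5 (seat prover-pub-hodgecm2-p2, binder
prover 2, gen 23).  Theorems only; no definition, no named fact, nothing asserted.  Composition BY NAME of F4
(`CorCM/PerLHodgeFourCoreAnyFamily.lean`), the tree's realisation of every CM type (`Domination.isCMTypeRealisation_cmCode`, read over the field;
Shimura §6.2 Thm. 3 as the record `CMAbelianVarietyRealised`, discharged by `cmAbelianVarietyRealised_holds`) and b25's multiplicativity of the
Hodge conjecture across CM products with disjoint Galois closures (`CorCM/DisjointCMProductsHodge.lean`); nothing of theirs is restated.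
NOT an E term, NOT a display of record, no BINDER-OWNERS row; `Interfaces.lean` (C1), `Assembly/ModelChain*.lean` and the `PerL` interface
untouched — `Universe.PerL` is consumed BY NAME only.

HONEST FRAMING (COORDINATOR RULING — HODGE FRAMING CORRECTION, 2026-08-21T11:55:35Z): `HC_CM` is NOT proved, here or anywhere in the
tree; `PerL(U_rec)` is proved by no tree term.  This file states the named class that `PerL` certifies INTRINSICALLY (no auxiliary «four
cores» in the hypotheses) and extends it to two stage-1 fields with disjoint Galois closures.
-/
import Summits.HodgeConjecture.CorCM.PerLHodgeFourCoreAnyFamily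
import Summits.HodgeConjecture.CorCM.DisjointCMProductsHodge
import Summits.HodgeConjecture.CorCM.Model.DimZeroDomination
import HarnessLib

/-!
# `PerL` ⟹ the Hodge conjecture for every product of abelian varieties with complex multiplication by the sextic field — intrinsic form

F4 (`PerLFourCore.hodgeConjectureFor_of_avDominatedBy_anyFamily_of_perL_rec`) still carried the auxiliary «four cores» `A₄ b ⊨ (K; Φ₄ b)`
(pairwise inequivalent types) in its hypotheses.  Here they are constructed (§1), so the statements are intrinsic:

* §1 `exists_fourCores` — a sextic CM field has four CM types which are pairwise different and pairwise non-conjugate (`Φ₀` and its three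
  one-place flips `flip s_b Φ₀`, `CMTypeOps.flip`), each realised by a CM abelian threefold (`Domination.isCMTypeRealisation_cmCode` at
  `cmAbelianVarietyRealised_holds`).
* §2 **`hodgeConjectureFor_of_avDominatedBy_cmByK_of_perL_rec`** — `K` sextic CM with normal closure of degree `24` or `48`:
  `PerL(U_rec)` ⟹ for EVERY finite family `X_j ⊨ (K; τ_j)` (any CM types, any multiplicities, any realisations) and every complex abelian
  variety `B` dominated by `⨁_j X_j`, `HodgeConjectureFor B.dim B.X`; `…_of_perLAt_rec` — the same from `PerL`'s conclusion at the ONE field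
  `K`; `hodgeConjectureFor_cmByK_iff_…`-free UNCONDITIONAL form `exists_twelvefold_reduction`: there are four CM threefolds `A₄` with CM by
  `K` such that HC² on `X₀ × X₁ × X₂ × X₃` implies the Hodge conjecture for all of the above.
* §3 **two fields** `hodgeConjectureFor_of_avDominatedBy_prod_cmByK_of_perL_rec` — `K₁`, `K₂` two stage-1 sextic fields whose Galois closures
  in `ℂ` meet in `ℚ`: `PerL(U_rec)` ⟹ the Hodge conjecture for every `B` dominated by `(⨁_j X_j) × (⨁_j Y_j)`, `X_j` with CM by `K₁`, `Y_j`
  with CM by `K₂` (b25's `hodgeConjectureFor_of_avDominatedBy_prod_of_normalClosure_inf_eq_bot`).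

One sentence (writers decide): «PerL(U_rec) implies the Hodge conjecture for every complex abelian variety dominated by a product of abelian
varieties with complex multiplication by one sextic CM field of the stage-1 class — and by two such fields with disjoint Galois closures.»
A NAMED CLASS conditional on stage 1's statement; NOT `HC_CM`, not `PerLFace`.

## References
* [Shimura1998] G. Shimura, *Abelian Varieties with Complex Multiplication and Modular Functions* (1998), §6.1 Cor., §6.2 Thm. 3, §8.4.
* [Dodson1984] B. Dodson, Trans. AMS 283 (1984), §5.1.  [MumfordAV1970] D. Mumford, §19.  [Pohlmann1968] H. Pohlmann, Thm 1.
* [Gordon1999HodgeAVSurvey] B. B. Gordon, §3 Theorem (Imai, Murty).  [Milne2020HodgeClassesAV] J. S. Milne (2020), Theorem 1.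
-/

noncomputable section

open CategoryTheory CategoryTheory.Limits NumberField IntermediateField
open Literature.AlgebraicGeometry Literature.AlgebraicGeometry.Motives Literature.AlgebraicGeometry.HodgeTheory
open Literature.AlgebraicGeometry.ComplexMultiplication (IsCMTypeRealisation)
open Literature.NumberTheory.ComplexMultiplication.CMTypeOps
open Literature.NumberTheory.Automorphic
open Summit.HodgeConjecture.CorCM.Domination

namespace Summit.HodgeConjecture.CorCM.PerLFourCore

/-! ## §1 Four pairwise inequivalent CM types of a sextic CM field, realised -/

section Cores

variable {K : Type} [Field K] [NumberField K] [IsCMField K]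

omit [NumberField K] [IsCMField K] in
/-- For `p ∈ Φ`: `p ∉ Φ^{(p)}`. [folklore] -/
private theorem not_mem_flip_self {Φ : CMType K} {p : K →+* ℂ} (hp : p ∈ Φ.1) : p ∉ (flip p Φ).1 := by
  rw [mem_flip_iff]
  rintro (⟨-, h⟩ | ⟨-, h⟩)
  · exact h (Or.inl rfl)
  · exact h hp

omit [NumberField K] [IsCMField K] in
/-- For `p, q ∈ Φ` with `q ≠ p`: `q ∈ Φ^{(p)}` (the flip only moves the place of `p`; `q ≠ p̄` because `p̄ ∉ Φ`). [folklore] -/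
private theorem mem_flip_of_mem_of_ne {Φ : CMType K} {p q : K →+* ℂ} (hp : p ∈ Φ.1) (hq : q ∈ Φ.1) (hqp : q ≠ p) :
    q ∈ (flip p Φ).1 := by
  rw [mem_flip_iff]
  refine Or.inl ⟨hq, ?_⟩
  rintro (h | h)
  · exact hqp h
  · exact ((mem_iff_conjugate_notMem Φ p).1 hp) (h ▸ hq)

/-- **A sextic CM field has four pairwise inequivalent CM types** — pairwise different (`hne`) and pairwise non-conjugate (`hnc`), in the
witness form of b25's `exists_frame_normalForm`: a CM type `Φ₀` (three embeddings at the three places) and its three one-place flips.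
[cite: Shimura1998, §8.4 (CM types of a sextic field)] -/
theorem exists_four_pairwise_inequivalent (h6 : Module.finrank ℚ K = 6) :
    ∃ Φ₄ : Fin 4 → CMType K,
      (∀ a b : Fin 4, a ≠ b → ∃ s, ¬ (s ∈ (Φ₄ a).1 ↔ s ∈ (Φ₄ b).1)) ∧
      (∀ a b : Fin 4, a ≠ b → ∃ s, ¬ (s ∈ (Φ₄ a).1 ↔ s ∉ (Φ₄ b).1)) := by
  classical
  obtain ⟨Φ₀⟩ := Summit.HodgeConjecture.CorCM.nonempty_cmType K
  have h3 : Φ₀.1.ncard = 3 := by have := GenericCMField.two_mul_ncard_cmType Φ₀; omega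
  obtain ⟨x, y, z, hxy, hxz, hyz, hΦ₀⟩ := Set.ncard_eq_three.1 h3
  have hx : x ∈ Φ₀.1 := by rw [hΦ₀]; simp
  have hy : y ∈ Φ₀.1 := by rw [hΦ₀]; simp
  have hz : z ∈ Φ₀.1 := by rw [hΦ₀]; simp
  -- the three flips, indexed by `Fin 3`
  let t : Fin 3 → (K →+* ℂ) := ![x, y, z]
  have ht : ∀ i, t i ∈ Φ₀.1 := by intro i; fin_cases i <;> assumption
  have htinj : ∀ i j, i ≠ j → t i ≠ t j := by
    intro i j hij; fin_cases i <;> fin_cases j <;> first | exact absurd rfl hij | simp [t, hxy, hxz, hyz, hxy.symm, hxz.symm, hyz.symm]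
  -- a third index
  have hthird : ∀ i j : Fin 3, ∃ k, k ≠ i ∧ k ≠ j := by decide
  refine ⟨Fin.cons Φ₀ fun i => flip (t i) Φ₀, fun a b hab => ?_, fun a b hab => ?_⟩
  · -- `hne`: a witness lying in exactly one of the two types
    rcases Fin.eq_zero_or_eq_succ a with rfl | ⟨i, rfl⟩ <;> rcases Fin.eq_zero_or_eq_succ b with rfl | ⟨j, rfl⟩
    · exact absurd rfl hab
    · exact ⟨t j, by simp only [Fin.cons_zero, Fin.cons_succ]; exact fun h => not_mem_flip_self (ht j) (h.1 (ht j))⟩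
    · exact ⟨t i, by simp only [Fin.cons_zero, Fin.cons_succ]; exact fun h => not_mem_flip_self (ht i) (h.2 (ht i))⟩
    · have hij : i ≠ j := fun h => hab (by rw [h])
      exact ⟨t i, by
        simp only [Fin.cons_succ]
        exact fun h => not_mem_flip_self (ht i) (h.2 (mem_flip_of_mem_of_ne (ht j) (ht i) (htinj i j hij)))⟩
  · -- `hnc`: a witness lying in both types
    rcases Fin.eq_zero_or_eq_succ a with rfl | ⟨i, rfl⟩ <;> rcases Fin.eq_zero_or_eq_succ b with rfl | ⟨j, rfl⟩
    · exact absurd rfl hab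
    · obtain ⟨k, -, hkj⟩ := hthird j j
      exact ⟨t k, by
        simp only [Fin.cons_zero, Fin.cons_succ]
        exact fun h => (h.1 (ht k)) (mem_flip_of_mem_of_ne (ht j) (ht k) (htinj k j hkj))⟩
    · obtain ⟨k, -, hki⟩ := hthird i i
      exact ⟨t k, by
        simp only [Fin.cons_zero, Fin.cons_succ]
        exact fun h => (h.1 (mem_flip_of_mem_of_ne (ht i) (ht k) (htinj k i hki))) (ht k)⟩
    · obtain ⟨k, hki, hkj⟩ := hthird i j
      exact ⟨t k, by
        simp only [Fin.cons_succ]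
        exact fun h => (h.1 (mem_flip_of_mem_of_ne (ht i) (ht k) (htinj k i hki)))
          (mem_flip_of_mem_of_ne (ht j) (ht k) (htinj k j hkj))⟩

/-- **Four cores.**  A sextic CM field `K` has four CM types `Φ₄ b`, pairwise different and pairwise non-conjugate, each realised on `H¹` by
a complex abelian variety (`Domination.isCMTypeRealisation_cmCode` at the tree theorem `cmAbelianVarietyRealised_holds`, Shimura §6.2 Thm. 3).
[cite: Shimura1998, §6.2 Theorem 3 (pp. 41–42) and §8.4] -/
theorem exists_fourCores (h6 : Module.finrank ℚ K = 6) :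
    ∃ (Φ₄ : Fin 4 → CMType K) (A₄ : Fin 4 → AbelianVariety ℂ) (ι₄ : ∀ b, 𝓞 K →+* End (A₄ b))
      (θ₄ : ∀ b, K →+* Module.End ℂ (complexBetti (A₄ b).X 1)),
      (∀ b, IsCMTypeRealisation (Φ₄ b) (A₄ b) (ι₄ b) (θ₄ b)) ∧
      (∀ a b : Fin 4, a ≠ b → ∃ s, ¬ (s ∈ (Φ₄ a).1 ↔ s ∈ (Φ₄ b).1)) ∧
      (∀ a b : Fin 4, a ≠ b → ∃ s, ¬ (s ∈ (Φ₄ a).1 ↔ s ∉ (Φ₄ b).1)) := by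
  obtain ⟨Φ₄, hne, hnc⟩ := exists_four_pairwise_inequivalent h6
  exact ⟨Φ₄, _, _, _, fun b => isCMTypeRealisation_cmCode K cmAbelianVarietyRealised_holds (Φ₄ b), hne, hnc⟩

end Cores

/-! ## §2 `PerL` ⟹ the Hodge conjecture for every product of CM abelian varieties with CM by `K` — intrinsic -/

section OneField

variable {K : CMField} {N : ℕ} {X : Fin (N + 1) → AbelianVariety ℂ} {τ : Fin (N + 1) → CMType (K : Type)}
  {act : ∀ j, 𝓞 (K : Type) →+* End (X j)} {θX : ∀ j, (K : Type) →+* Module.End ℂ (complexBetti (X j).X 1)}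

/-- **FIELD-LOCAL, intrinsic.**  `K` sextic CM with normal closure `L` of degree `24` or `48`.  If `PerL`'s conclusion holds AT `K` on the
universe of record, then every complex abelian variety dominated by a finite product `⨁_j X_j` of abelian varieties with complex
multiplication by `K` — `X_j ⊨ (K; τ_j)`, ANY CM types, multiplicities, realisations — satisfies the Hodge conjecture in every codimension.
FRAMING: a NAMED CLASS conditional on a period statement; NOT `HC_CM`. [cite: Shimura1998, §6.1 Corollary and §6.2 Theorem 3]
[cite: Pohlmann1968, Thm 1] [cite: Milne2020HodgeClassesAV, Theorem 1] -/
theorem hodgeConjectureFor_of_avDominatedBy_cmByK_of_perLAt_rec (L : CMField)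
    (j : (K : Type) →+* (L : Type)) (hN : IsNormalClosure ℚ (K : Type) (L : Type))
    (h6 : Module.finrank ℚ K = 6) (hL : Module.finrank ℚ L = 24 ∨ Module.finrank ℚ L = 48)
    (hK : ∀ (φ : Fin 3 → ((K : Type) →+* ℂ)), IsFrame φ → ∀ (ι₁ : (L : Type) →+* ℂ), ι₁.comp j = φ 0 →
      ∀ (t : Fin 4 → CMType (K : Type)), IsPerLTypes φ t → ∃ V : HermSpace3 L ι₁,
        (Model.picardCMUniverse exists_isReal_hodgeModel_holds hodgePQ_independent_of_hodgeModel_holds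
          BallQuotient.ballQuotientUniformised_holds cmAbelianVarietyRealised_holds).PeriodNV ι₁ V K t (φ 0))
    (hX : ∀ j, IsCMTypeRealisation (τ j) (X j) (act j) (θX j)) {B : AbelianVariety ℂ} (hB : AVDominatedBy B (⨁ X)) :
    HodgeConjectureFor B.dim B.X := by
  obtain ⟨Φ₄, A₄, ι₄, θ₄, hA, hne, hnc⟩ := exists_fourCores (K := (K : Type)) h6
  exact hodgeConjectureFor_of_avDominatedBy_anyFamily_of_perLAt_rec L j hN h6 hL hK hA hne hnc hX hB

/-- **`PerL(U_rec)` ⟹ the Hodge conjecture for every complex abelian variety dominated by a finite product of abelian varieties with complex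
multiplication by `K`** (`K` sextic CM, normal closure of degree `24` or `48`; ANY CM types `τ_j`, multiplicities, realisations).  No auxiliary
data.  `Universe.PerL` consumed BY NAME.  FRAMING: a NAMED CLASS conditional on stage 1's statement; `PerL(U_rec)` is proved by no tree term;
NOT `HC_CM`, not `PerLFace`. [cite: Shimura1998, §6.1 Corollary and §6.2 Theorem 3] [cite: Pohlmann1968, Thm 1]
[cite: Milne2020HodgeClassesAV, Theorem 1] [cite: MumfordAV1970, §19] -/
theorem hodgeConjectureFor_of_avDominatedBy_cmByK_of_perL_rec
    (hP : (Model.picardCMUniverse exists_isReal_hodgeModel_holds hodgePQ_independent_of_hodgeModel_holds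
      BallQuotient.ballQuotientUniformised_holds cmAbelianVarietyRealised_holds).PerL)
    (L : CMField) (j : (K : Type) →+* (L : Type)) (hN : IsNormalClosure ℚ (K : Type) (L : Type))
    (h6 : Module.finrank ℚ K = 6) (hL : Module.finrank ℚ L = 24 ∨ Module.finrank ℚ L = 48)
    (hX : ∀ j, IsCMTypeRealisation (τ j) (X j) (act j) (θX j)) {B : AbelianVariety ℂ} (hB : AVDominatedBy B (⨁ X)) :
    HodgeConjectureFor B.dim B.X :=
  hodgeConjectureFor_of_avDominatedBy_cmByK_of_perLAt_rec L j hN h6 hL (hP K L j hN h6 hL) hX hB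

/-- The product `⨁_j X_j` itself, from `PerL(U_rec)`. [cite: Pohlmann1968, Thm 1] [cite: Milne2020HodgeClassesAV, Theorem 1] -/
theorem hodgeConjectureFor_cmByK_of_perL_rec
    (hP : (Model.picardCMUniverse exists_isReal_hodgeModel_holds hodgePQ_independent_of_hodgeModel_holds
      BallQuotient.ballQuotientUniformised_holds cmAbelianVarietyRealised_holds).PerL)
    (L : CMField) (j : (K : Type) →+* (L : Type)) (hN : IsNormalClosure ℚ (K : Type) (L : Type))
    (h6 : Module.finrank ℚ K = 6) (hL : Module.finrank ℚ L = 24 ∨ Module.finrank ℚ L = 48)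
    (hX : ∀ j, IsCMTypeRealisation (τ j) (X j) (act j) (θX j)) : HodgeConjectureFor (⨁ X).dim (⨁ X).X :=
  hodgeConjectureFor_of_avDominatedBy_cmByK_of_perL_rec hP L j hN h6 hL hX (AVDominatedBy.refl _)

/-- **UNCONDITIONAL: one twelvefold governs the class.**  For a sextic CM field `K` with normal closure of degree `24` or `48` there are four
CM abelian threefolds `A₄ b` with CM by `K` (pairwise inequivalent types) such that: if every rational `(2,2)`-class of
`X₀ × X₁ × X₂ × X₃ = ⨁ A₄` is algebraic, then every complex abelian variety dominated by a finite product of abelian varieties with complex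
multiplication by `K` satisfies the Hodge conjecture.  Neither side is asserted. [cite: Pohlmann1968, Thm 1] [cite: Shimura1998, §6.1 Corollary] -/
theorem exists_twelvefold_reduction (L : Type) [Field L] [NumberField L] [IsNormalClosure ℚ (K : Type) L]
    (h6 : Module.finrank ℚ K = 6) (hL : Module.finrank ℚ L = 24 ∨ Module.finrank ℚ L = 48) :
    ∃ (Φ₄ : Fin 4 → CMType (K : Type)) (A₄ : Fin 4 → AbelianVariety ℂ) (ι₄ : ∀ b, 𝓞 (K : Type) →+* End (A₄ b))
      (θ₄ : ∀ b, (K : Type) →+* Module.End ℂ (complexBetti (A₄ b).X 1)),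
      (∀ b, IsCMTypeRealisation (Φ₄ b) (A₄ b) (ι₄ b) (θ₄ b)) ∧
      ((∀ c : complexBetti (⨁ A₄).X (2 * 2), IsRationalClass c →
          IsOfHodgeType (⨁ A₄).dim (⨁ A₄).X (2 * 2) 2 2 c → c ∈ algebraicClasses (⨁ A₄).X 2) →
        ∀ {N : ℕ} {X : Fin (N + 1) → AbelianVariety ℂ} {τ : Fin (N + 1) → CMType (K : Type)}
          {act : ∀ j, 𝓞 (K : Type) →+* End (X j)} {θX : ∀ j, (K : Type) →+* Module.End ℂ (complexBetti (X j).X 1)},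
          (∀ j, IsCMTypeRealisation (τ j) (X j) (act j) (θX j)) →
          ∀ {B : AbelianVariety ℂ}, AVDominatedBy B (⨁ X) → HodgeConjectureFor B.dim B.X) := by
  obtain ⟨Φ₄, A₄, ι₄, θ₄, hA, hne, hnc⟩ := exists_fourCores (K := (K : Type)) h6
  exact ⟨Φ₄, A₄, ι₄, θ₄, hA, fun h2 _ _ _ _ _ hX _ hB =>
    hodgeConjectureFor_of_avDominatedBy_anyFamily_of_hodgeClasses_two h6 L hL hA hne hnc h2 hX hB⟩

end OneField

/-! ## §3 Two stage-1 fields with disjoint Galois closures -/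

section TwoFields

variable {K₁ K₂ : CMField} {N₁ N₂ : ℕ}
  {X : Fin (N₁ + 1) → AbelianVariety ℂ} {τ : Fin (N₁ + 1) → CMType (K₁ : Type)}
  {actX : ∀ j, 𝓞 (K₁ : Type) →+* End (X j)} {θX : ∀ j, (K₁ : Type) →+* Module.End ℂ (complexBetti (X j).X 1)}
  {Y : Fin (N₂ + 1) → AbelianVariety ℂ} {υ : Fin (N₂ + 1) → CMType (K₂ : Type)}
  {actY : ∀ j, 𝓞 (K₂ : Type) →+* End (Y j)} {θY : ∀ j, (K₂ : Type) →+* Module.End ℂ (complexBetti (Y j).X 1)}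

/-- **TWO FIELDS.**  `K₁`, `K₂` sextic CM fields with normal closures of degree `24` or `48` whose Galois closures in `ℂ` meet in `ℚ`
(`normalClosure ℚ K₁ ℂ ⊓ normalClosure ℚ K₂ ℂ = ⊥`): `PerL(U_rec)` ⟹ the Hodge conjecture for every complex abelian variety dominated by
`(⨁_j X_j) × (⨁_j Y_j)`, `X_j ⊨ (K₁; τ_j)`, `Y_j ⊨ (K₂; υ_j)` ANY CM types (§2 for each field + b25's multiplicativity across disjoint closures,
Moonen–Zarhin (3.1) / Gordon §3).  FRAMING: a NAMED CLASS conditional on stage 1's statement; NOT `HC_CM`.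
[cite: Gordon1999HodgeAVSurvey, §3 Theorem (Imai, Murty) with proof] [cite: MoonenZarhin1999LowDim, §3 (3.1)] [cite: Milne2020HodgeClassesAV, Theorem 1] -/
theorem hodgeConjectureFor_of_avDominatedBy_prod_cmByK_of_perL_rec
    (hP : (Model.picardCMUniverse exists_isReal_hodgeModel_holds hodgePQ_independent_of_hodgeModel_holds
      BallQuotient.ballQuotientUniformised_holds cmAbelianVarietyRealised_holds).PerL)
    (L₁ : CMField) (j₁ : (K₁ : Type) →+* (L₁ : Type)) (hN₁ : IsNormalClosure ℚ (K₁ : Type) (L₁ : Type))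
    (h6₁ : Module.finrank ℚ K₁ = 6) (hL₁ : Module.finrank ℚ L₁ = 24 ∨ Module.finrank ℚ L₁ = 48)
    (L₂ : CMField) (j₂ : (K₂ : Type) →+* (L₂ : Type)) (hN₂ : IsNormalClosure ℚ (K₂ : Type) (L₂ : Type))
    (h6₂ : Module.finrank ℚ K₂ = 6) (hL₂ : Module.finrank ℚ L₂ = 24 ∨ Module.finrank ℚ L₂ = 48)
    (H : normalClosure ℚ (K₁ : Type) ℂ ⊓ normalClosure ℚ (K₂ : Type) ℂ = ⊥)
    (hX : ∀ j, IsCMTypeRealisation (τ j) (X j) (actX j) (θX j)) (hY : ∀ j, IsCMTypeRealisation (υ j) (Y j) (actY j) (θY j))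
    {B : AbelianVariety ℂ} (hB : AVDominatedBy B ((⨁ X).prod (⨁ Y))) : HodgeConjectureFor B.dim B.X := by
  have H' : (⨆ _ : Fin (N₁ + 1), normalClosure ℚ (K₁ : Type) ℂ) ⊓ (⨆ _ : Fin (N₂ + 1), normalClosure ℚ (K₂ : Type) ℂ) = ⊥ := by
    rwa [iSup_const, iSup_const]
  exact hodgeConjectureFor_of_avDominatedBy_prod_of_normalClosure_inf_eq_bot (K := fun _ : Fin (N₁ + 1) => (K₁ : Type))
    (K' := fun _ : Fin (N₂ + 1) => (K₂ : Type)) hX hY H' (AbelianVariety.IsIsogenous.refl _) (AbelianVariety.IsIsogenous.refl _)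
    (hodgeConjectureFor_cmByK_of_perL_rec hP L₁ j₁ hN₁ h6₁ hL₁ hX)
    (hodgeConjectureFor_cmByK_of_perL_rec hP L₂ j₂ hN₂ h6₂ hL₂ hY) hB

end TwoFields

end Summit.HodgeConjecture.CorCM.PerLFourCore
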